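import Summits.CriticalPhenomena.PercolationContinuityZ3.Theorems.PercNearOneGluingNoHeavyQuantFarBlockIntrinsicCore
import HarnessLib

/-!
# QUANT lane R8, front "FAR beyond trees", layer one — the INTRINSIC (environment-universal) criterion for a pendant block:
# `q − t_S ≤ P(X = 1)·(2 − M_in)` gives FAR(1) in EVERY environment, with no comparison block and no induction

builds on p205010 (kernel theorem, internal audit signed; external expert review pending)

Support file (`--supports stmt-CriticalPhenomena-4575`), seat `prim-quant-p1` (gen 24); memo
`run/shared/lean/prim/quant/prim-quant-p1-g24/FOR-LEAD-INTRINSIC.md`.  Standard axioms; no sorries; no definitions.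

SETTING (as in `…QuantFarBlockLaw` / `…BlockTransfer` / `…BlockEnvExit`, p1 g19/g23).  A block `Z` hangs at the cut vertex `c` of a finite
weighted graph `w` (`o, c ∉ Z`, `w` vanishes between `Z` and `(Z ∪ {c})ᶜ`); relays `A`; `X = #{a ∈ A ∩ Z : c ↔ a on Z}` with block numbers
`h_S = P(X ≥ 1)`, `t_S = P(X ≥ 2)`; internal marginals `τ_a = P(c ↔ a on Z)` and INSIDE MEAN `M_in = Σ_{a ∈ A ∩ Z} τ_a`; a block relay `a₀` with
`τ₀ = τ_{a₀}`; environment coefficients `A₀ = P(#out ≥ 2)`, `B = P(#out = 1 ∧ o ↔ c off Z)`, `C = P(#out = 0 ∧ o ↔ c off Z)`, `g = P(o ↔ c off Z)`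
(`#out` = number of relays of `A ∖ Z` joined to `o` off `Z`), so that `P_w(N ≥ 2) = A₀ + B·h_S + C·t_S` (`Block.real_two_le_card_eq`).

WHY.  p1 g23 (`…QuantFarCoreBlockLocalityFalse`) showed that the environment-AGNOSTIC transfer (domination of independent stems,
`Block.real_card_le_one_le_of_dominates`) fails for junction cores (pendant `K₂,₃`, `θ(3,3,3)`, `K₃,₃`): `t_S < min(t^⊥, q)`.  This file proves that
such blocks nevertheless satisfy FAR(1) in every environment, by an argument that uses the FAR hypotheses at the OBSERVER (`EN > 2`, all cuts `≤ t`)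
directly against the environment: Harris twice (`g·P(#out ≥ 1) ≤ A₀ + B`, p1 g23), the mass bound `A₀ + B + C ≥ g`, and the first-moment count
`Σ_{a ∉ Z} P(o ↔ a) ≤ P(#out = 1) + |A ∖ Z|·P(#out ≥ 2)` (so that `A₀ ≥ (1 − t)(1 − P(#out = 1)/Σ_out)`).

Part I (`…QuantFarBlockIntrinsicCore`): the arithmetic core `Block.intrinsic_arith`, the first-moment count, Harris inside the block.
* `Block.real_intrinsic_env` — the environment lemma: the FAR hypotheses at the observer give `1 − t ≤ A₀ + B h + C d` for EVERY pair of reals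
  `0 ≤ d ≤ h`, `d ≤ 1` satisfying (B1)–(B2) below (not only the block's own numbers).
* **`Block.real_card_le_one_le_intrinsic`** — MAIN THEOREM: if `M_in ≤ 2`, (B1) `τ₀²(1 − t_S) ≤ 2 t_S (1 − τ₀)` and
  **(B2) `τ₀(1 − t_S) ≤ t_S(1 − τ₀) + (h_S − t_S)(2 − M_in)`**, i.e. `τ₀ − t_S ≤ P(X = 1)·(2 − M_in)`, then `2 < Σ_{a∈A} P(o ↔ a)` and `P(o ↮ a) ≤ t` on `A`
  give `P_w(N ≤ 1) ≤ t` — for EVERY environment outside `Z`.  (B1) is automatic when a second block relay has internal marginal `≥ τ₀` (Harris: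
  `t_S ≥ τ₀²`, part I): corollary **`Block.real_card_le_one_le_intrinsic₂`**.  (B2) is NECESSARY for FAR(1) when `τ₀ + M_in ≤ 2`
  (environment `o = c` plus one independent hair of weight `↓ 2 − M_in`), so in that regime the theorem is sharp: environment-universality of FAR(1)
  for a light block is decided by the one-hair environment.
* `Block.real_card_le_one_le_of_mixIntrinsic` — the `λ`-mixture with a comparison block `w'` (agreeing off `Z`, `P_{w'}(N ≤ 1) ≤ t`): it suffices that
  the VIRTUAL numbers `((h_S − λh')/(1−λ), (t_S − λt')/(1−λ))` satisfy (B1)–(B2) (stated division-free); `λ = 0` is the main theorem, and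
  `Block.real_card_le_one_le_of_dominates` is the boundary case where the virtual block exits.
NUMBERS (memo §3; exact engine `quant/prim-quant-p1-g24/num/`): the `K₂,₃` witness of p1 g23 (`19/40`, `9/40`) has `τ₀ − t_S ≈ 1.1·10⁻³` against
`P(X=1)(2 − M_in) ≈ 0.180`; on the 19 symmetric junction-core families of p1 g23's scan (sure relays, `1/30` grid, 841 points each) EVERY point is
`t_S ≥ τ₀` (exit) or satisfies (B2) with `M_in ≤ 2` — no point needs a comparison block.
[cite: Grimmett1999, §1.3 p. 10; Thm. (2.4) p. 34] (product measure, Harris); [cite: KozmaNitzan2024, Conjecture 3 (p. 15)] (context: FAR is the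
`j = 1` far-relay row); the theorems [this work].
-/

noncomputable section

namespace Summit.CriticalPhenomena.PercolationContinuityZ3.Theorems

namespace Quant

namespace Block

open Finset MeasureTheory Set
open Literature.Probability.LatticeModels
open Literature.Probability.Percolation
open Bundle (offZ avoid offZ_subset real_offZ_event_eq_of_agree)
open scoped Classical

variable {n : ℕ} {o c : Fin n} {Z : Finset (Fin n)}

/-! ## The environment lemma and the main theorem -/

/-- **Environment lemma.**  Block `Z` at `c` (`o, c ∉ Z`, `w` vanishes between `Z` and `(Z ∪ {c})ᶜ`), relays `A` with `P(o ↮ a) ≤ t` on `A` and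
`2 < Σ_{a∈A} P(o ↔ a)`, a block relay `a₀` (internal marginal `τ₀`), inside mean `M_in ≤ 2`.  Then for ALL reals `0 ≤ d ≤ h`, `d ≤ 1` with
(B1) `τ₀²(1−d) ≤ 2d(1−τ₀)` and (B2) `τ₀(1−d) ≤ d(1−τ₀) + (h−d)(2 − M_in)`:  `1 − t ≤ A₀ + B·h + C·d` (environment coefficients of `w`).
The block numbers `(h_S, t_S)` are one admissible choice (main theorem); virtual numbers give the mixed criterion. [this work] -/
theorem real_intrinsic_env (w : Sym2 (Fin n) → unitInterval) (ho : o ∉ Z) (hc : c ∉ Z)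
    (hw : ∀ x y : Fin n, x ≠ y → x ∈ Z → y ∉ Z → y ≠ c → (w s(x, y) : ℝ) = 0)
    (A : Finset (Fin n)) (t : ℝ) {a₀ : Fin n} (ha₀ : a₀ ∈ A ∩ Z)
    (hcut : ∀ a ∈ A, (prodBernoulli w).real (openConn o a)ᶜ ≤ t)
    (hEN : (2 : ℝ) < ∑ a ∈ A, (prodBernoulli w).real (openConn o a))
    (hM : ∑ a ∈ A ∩ Z, (prodBernoulli w).real {ω | onZ Z ω ∈ openConn c a} ≤ 2)
    {h d : ℝ} (hd0 : 0 ≤ d) (hdh : d ≤ h) (hd1 : d ≤ 1)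
    (hB1 : (prodBernoulli w).real {ω | onZ Z ω ∈ openConn c a₀} ^ 2 * (1 - d) ≤
      2 * d * (1 - (prodBernoulli w).real {ω | onZ Z ω ∈ openConn c a₀}))
    (hB2 : (prodBernoulli w).real {ω | onZ Z ω ∈ openConn c a₀} * (1 - d) ≤
      d * (1 - (prodBernoulli w).real {ω | onZ Z ω ∈ openConn c a₀}) +
        (h - d) * (2 - ∑ a ∈ A ∩ Z, (prodBernoulli w).real {ω | onZ Z ω ∈ openConn c a})) :
    1 - t ≤ (prodBernoulli w).real {ω | 2 ≤ ((A \ Z).filter fun a => offZ Z ω ∈ openConn o a).card} +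
      (prodBernoulli w).real {ω | ((A \ Z).filter fun a => offZ Z ω ∈ openConn o a).card = 1 ∧ offZ Z ω ∈ openConn o c} * h +
      (prodBernoulli w).real {ω | ((A \ Z).filter fun a => offZ Z ω ∈ openConn o a).card = 0 ∧ offZ Z ω ∈ openConn o c} * d := by
  set μ := prodBernoulli w with hμ
  have hmeas : ∀ U : Set (BondConfig (Fin n)), MeasurableSet U := fun U => (Set.toFinite U).measurableSet
  set A0 := μ.real {ω | 2 ≤ ((A \ Z).filter fun a => offZ Z ω ∈ openConn o a).card} with hA0
  set P1 := μ.real {ω | ((A \ Z).filter fun a => offZ Z ω ∈ openConn o a).card = 1} with hP1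
  set B := μ.real {ω | ((A \ Z).filter fun a => offZ Z ω ∈ openConn o a).card = 1 ∧ offZ Z ω ∈ openConn o c} with hB
  set C := μ.real {ω | ((A \ Z).filter fun a => offZ Z ω ∈ openConn o a).card = 0 ∧ offZ Z ω ∈ openConn o c} with hC
  set g := μ.real {ω | offZ Z ω ∈ openConn o c} with hg
  set τ₀ := μ.real {ω | onZ Z ω ∈ openConn c a₀} with hτ₀
  set M := ∑ a ∈ A ∩ Z, μ.real {ω | onZ Z ω ∈ openConn c a} with hMdef
  set U := μ.real {ω | 1 ≤ ((A \ Z).filter fun a => offZ Z ω ∈ openConn o a).card} with hU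
  set Sig := ∑ a ∈ A \ Z, μ.real (openConn o a) with hSig
  set K : ℝ := ((A \ Z).card : ℝ) with hK
  set x := 1 - t with hx
  -- environment facts
  have hJ : g ≤ A0 + B + C := real_inter_J_le μ (A \ Z)
  have hHarU : U * g ≤ A0 + B := real_outCount_inter_ge w (A \ Z)
  have hUeq : U = P1 + A0 := by
    have hset : {ω : BondConfig (Fin n) | 1 ≤ ((A \ Z).filter fun a => offZ Z ω ∈ openConn o a).card} =
        {ω | ((A \ Z).filter fun a => offZ Z ω ∈ openConn o a).card = 1} ∪
          {ω | 2 ≤ ((A \ Z).filter fun a => offZ Z ω ∈ openConn o a).card} := by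
      ext ω; simp only [mem_setOf_eq, Set.mem_union]; omega
    have hdisj : Disjoint {ω : BondConfig (Fin n) | ((A \ Z).filter fun a => offZ Z ω ∈ openConn o a).card = 1}
        {ω | 2 ≤ ((A \ Z).filter fun a => offZ Z ω ∈ openConn o a).card} := by
      rw [Set.disjoint_left]; intro ω h1 h2; simp only [mem_setOf_eq] at h1 h2; omega
    rw [hU, hset, measureReal_union hdisj (hmeas _)]
  have hHar : (P1 + A0) * g ≤ A0 + B := by rw [← hUeq]; exact hHarU
  -- the outside sum: `Σ = Σ_{a ∉ Z} P(o ↔ a off Z)`, counting bounds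
  have hoff : ∀ a ∈ A \ Z, μ.real (openConn o a) = μ.real {ω | offZ Z ω ∈ openConn o a} :=
    fun a ha => real_openConn_off_eq (c := c) w ho hw (Finset.mem_sdiff.1 ha).2
  have hSig' : Sig = ∑ a ∈ A \ Z, μ.real {ω | offZ Z ω ∈ openConn o a} := Finset.sum_congr rfl hoff
  have hcnt := sum_real_le_one_add_card_mul_two μ (A \ Z) (fun a => {ω : BondConfig (Fin n) | offZ Z ω ∈ openConn o a})
  have hSigle : Sig ≤ P1 + K * A0 := by
    have h1 := hcnt.1
    simp only [mem_setOf_eq] at h1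
    rw [hSig']; exact h1
  have hP1S : P1 ≤ Sig := by
    have h2 := hcnt.2
    simp only [mem_setOf_eq] at h2
    rw [hSig']; exact h2
  have hKx : K * x ≤ Sig := by
    have : ∀ a ∈ A \ Z, x ≤ μ.real (openConn o a) := by
      intro a ha
      have h1 := hcut a (Finset.mem_sdiff.1 ha).1
      have h2 : μ.real (openConn o a : Set (BondConfig (Fin n)))ᶜ = 1 - μ.real (openConn o a) := probReal_compl_eq_one_sub (hmeas _)
      rw [hx]; linarith
    calc K * x = ∑ a ∈ A \ Z, x := by rw [Finset.sum_const, nsmul_eq_mul]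
      _ ≤ Sig := Finset.sum_le_sum this
  -- inside: `Σ_{a ∈ A ∩ Z} P(o ↔ a) = g·M`, hence `EN = Σ + gM`
  have hin : ∀ a ∈ A ∩ Z, μ.real (openConn o a) = g * μ.real {ω | onZ Z ω ∈ openConn c a} :=
    fun a ha => real_openConn_in_eq w ho hc hw (Finset.mem_inter.1 ha).2
  have hENeq : ∑ a ∈ A, μ.real (openConn o a) = Sig + g * M := by
    have hsplit := Finset.sum_sdiff (f := fun a => μ.real (openConn o a)) (Finset.inter_subset_left (s₁ := A) (s₂ := Z))
    have hsd : A \ (A ∩ Z) = A \ Z := by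
      ext a; simp only [Finset.mem_sdiff, Finset.mem_inter, not_and]; tauto
    rw [hsd] at hsplit
    rw [← hsplit, hMdef, Finset.mul_sum, Finset.sum_congr rfl hin]
  have hEN' : 2 < Sig + g * M := by rw [← hENeq]; exact hEN
  -- `x ≤ g τ₀`
  have hxg : x ≤ g * τ₀ := by
    have h1 := hcut a₀ (Finset.mem_inter.1 ha₀).1
    have h2 : μ.real (openConn o a₀ : Set (BondConfig (Fin n)))ᶜ = 1 - μ.real (openConn o a₀) := probReal_compl_eq_one_sub (hmeas _)
    have h3 := hin a₀ ha₀
    rw [hx]; linarith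
  -- ranges
  have hg1 : g ≤ 1 := measureReal_le_one
  have hτ1 : τ₀ ≤ 1 := measureReal_le_one
  have hτM : τ₀ ≤ M := by
    rw [hMdef]
    exact Finset.single_le_sum (f := fun a => μ.real {ω | onZ Z ω ∈ openConn c a}) (fun _ _ => measureReal_nonneg) ha₀
  exact intrinsic_arith measureReal_nonneg measureReal_nonneg measureReal_nonneg measureReal_nonneg
    measureReal_nonneg hg1 measureReal_nonneg hτ1 hd0 hdh hd1 hτM hM hJ hHar hKx hSigle hP1S hEN' hxg hB1 hB2

/-- The complement identity `P(N ≤ 1) = 1 − P(N ≥ 2)` for a probability measure. [folklore] -/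
theorem real_card_le_one_eq_one_sub (ν : Measure (BondConfig (Fin n))) [IsProbabilityMeasure ν] (A : Finset (Fin n)) (o : Fin n) :
    ν.real {ω : BondConfig (Fin n) | (A.filter fun a => ω ∈ openConn o a).card ≤ 1} =
      1 - ν.real {ω : BondConfig (Fin n) | 2 ≤ (A.filter fun a => ω ∈ openConn o a).card} := by
  have : {ω : BondConfig (Fin n) | (A.filter fun a => ω ∈ openConn o a).card ≤ 1} =
      {ω : BondConfig (Fin n) | 2 ≤ (A.filter fun a => ω ∈ openConn o a).card}ᶜ := by
    ext ω; simp only [mem_setOf_eq, Set.mem_compl_iff]; omega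
  rw [this, probReal_compl_eq_one_sub (Set.toFinite _).measurableSet]

/-- **INTRINSIC CRITERION (FAR at layer one in every environment).**  Block `Z` at `c` (`o, c ∉ Z`, `w` vanishes between `Z` and
`(Z ∪ {c})ᶜ`), relays `A` with `P(o ↮ a) ≤ t` for all `a ∈ A` and `2 < Σ_{a∈A} P(o ↔ a)`; a block relay `a₀ ∈ A ∩ Z` with internal marginal
`τ₀ = P(c ↔ a₀ on Z)`; block numbers `h_S = P(X ≥ 1)`, `t_S = P(X ≥ 2)`, inside mean `M_in = Σ_{a∈A∩Z} P(c ↔ a on Z) ≤ 2`.  If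
(B1) `τ₀²(1 − t_S) ≤ 2 t_S (1 − τ₀)` and (B2) `τ₀(1 − t_S) ≤ t_S(1 − τ₀) + (h_S − t_S)(2 − M_in)`, then `P_w(#{a ∈ A : o ↔ a} ≤ 1) ≤ t`.
No hypothesis on the graph outside `Z`. [this work] -/
theorem real_card_le_one_le_intrinsic (w : Sym2 (Fin n) → unitInterval) (ho : o ∉ Z) (hc : c ∉ Z)
    (hw : ∀ x y : Fin n, x ≠ y → x ∈ Z → y ∉ Z → y ≠ c → (w s(x, y) : ℝ) = 0)
    (A : Finset (Fin n)) (t : ℝ) {a₀ : Fin n} (ha₀ : a₀ ∈ A ∩ Z)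
    (hcut : ∀ a ∈ A, (prodBernoulli w).real (openConn o a)ᶜ ≤ t)
    (hEN : (2 : ℝ) < ∑ a ∈ A, (prodBernoulli w).real (openConn o a))
    (hM : ∑ a ∈ A ∩ Z, (prodBernoulli w).real {ω | onZ Z ω ∈ openConn c a} ≤ 2)
    (hB1 : (prodBernoulli w).real {ω | onZ Z ω ∈ openConn c a₀} ^ 2 *
        (1 - (prodBernoulli w).real {ω | 2 ≤ ((A ∩ Z).filter fun a => onZ Z ω ∈ openConn c a).card}) ≤
      2 * (prodBernoulli w).real {ω | 2 ≤ ((A ∩ Z).filter fun a => onZ Z ω ∈ openConn c a).card} *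
        (1 - (prodBernoulli w).real {ω | onZ Z ω ∈ openConn c a₀}))
    (hB2 : (prodBernoulli w).real {ω | onZ Z ω ∈ openConn c a₀} *
        (1 - (prodBernoulli w).real {ω | 2 ≤ ((A ∩ Z).filter fun a => onZ Z ω ∈ openConn c a).card}) ≤
      (prodBernoulli w).real {ω | 2 ≤ ((A ∩ Z).filter fun a => onZ Z ω ∈ openConn c a).card} *
          (1 - (prodBernoulli w).real {ω | onZ Z ω ∈ openConn c a₀}) +
        ((prodBernoulli w).real {ω | 1 ≤ ((A ∩ Z).filter fun a => onZ Z ω ∈ openConn c a).card} -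
            (prodBernoulli w).real {ω | 2 ≤ ((A ∩ Z).filter fun a => onZ Z ω ∈ openConn c a).card}) *
          (2 - ∑ a ∈ A ∩ Z, (prodBernoulli w).real {ω | onZ Z ω ∈ openConn c a})) :
    (prodBernoulli w).real {ω : BondConfig (Fin n) | (A.filter fun a => ω ∈ openConn o a).card ≤ 1} ≤ t := by
  have htShS : (prodBernoulli w).real {ω | 2 ≤ ((A ∩ Z).filter fun a => onZ Z ω ∈ openConn c a).card} ≤
      (prodBernoulli w).real {ω | 1 ≤ ((A ∩ Z).filter fun a => onZ Z ω ∈ openConn c a).card} := by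
    refine measureReal_mono (fun ω hω => ?_) (measure_ne_top _ _)
    simp only [mem_setOf_eq] at hω ⊢; omega
  have hkey := real_intrinsic_env w ho hc hw A t ha₀ hcut hEN hM measureReal_nonneg htShS measureReal_le_one hB1 hB2
  rw [real_card_le_one_eq_one_sub, real_two_le_card_eq w ho hc hw A]; linarith

/-- **INTRINSIC CRITERION, least-marginal form.**  As `real_card_le_one_le_intrinsic`, with (B1) discharged by Harris: it suffices that a second
block relay `a₁ ≠ a₀` of `A ∩ Z` has internal marginal `≥ τ₀` (e.g. `a₀` of least internal marginal), and
(B2) `τ₀(1 − t_S) ≤ t_S(1 − τ₀) + (h_S − t_S)(2 − M_in)` — equivalently `τ₀ − t_S ≤ P(X = 1)·(2 − M_in)`. [this work] -/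
theorem real_card_le_one_le_intrinsic₂ (w : Sym2 (Fin n) → unitInterval) (ho : o ∉ Z) (hc : c ∉ Z)
    (hw : ∀ x y : Fin n, x ≠ y → x ∈ Z → y ∉ Z → y ≠ c → (w s(x, y) : ℝ) = 0)
    (A : Finset (Fin n)) (t : ℝ) {a₀ a₁ : Fin n} (ha₀ : a₀ ∈ A ∩ Z) (ha₁ : a₁ ∈ A ∩ Z) (hne : a₀ ≠ a₁)
    (hle : (prodBernoulli w).real {ω | onZ Z ω ∈ openConn c a₀} ≤ (prodBernoulli w).real {ω | onZ Z ω ∈ openConn c a₁})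
    (hcut : ∀ a ∈ A, (prodBernoulli w).real (openConn o a)ᶜ ≤ t)
    (hEN : (2 : ℝ) < ∑ a ∈ A, (prodBernoulli w).real (openConn o a))
    (hM : ∑ a ∈ A ∩ Z, (prodBernoulli w).real {ω | onZ Z ω ∈ openConn c a} ≤ 2)
    (hB2 : (prodBernoulli w).real {ω | onZ Z ω ∈ openConn c a₀} *
        (1 - (prodBernoulli w).real {ω | 2 ≤ ((A ∩ Z).filter fun a => onZ Z ω ∈ openConn c a).card}) ≤
      (prodBernoulli w).real {ω | 2 ≤ ((A ∩ Z).filter fun a => onZ Z ω ∈ openConn c a).card} *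
          (1 - (prodBernoulli w).real {ω | onZ Z ω ∈ openConn c a₀}) +
        ((prodBernoulli w).real {ω | 1 ≤ ((A ∩ Z).filter fun a => onZ Z ω ∈ openConn c a).card} -
            (prodBernoulli w).real {ω | 2 ≤ ((A ∩ Z).filter fun a => onZ Z ω ∈ openConn c a).card}) *
          (2 - ∑ a ∈ A ∩ Z, (prodBernoulli w).real {ω | onZ Z ω ∈ openConn c a})) :
    (prodBernoulli w).real {ω : BondConfig (Fin n) | (A.filter fun a => ω ∈ openConn o a).card ≤ 1} ≤ t := by
  set τ₀ := (prodBernoulli w).real {ω | onZ Z ω ∈ openConn c a₀} with hτ₀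
  set τ₁ := (prodBernoulli w).real {ω | onZ Z ω ∈ openConn c a₁} with hτ₁
  set tS := (prodBernoulli w).real {ω | 2 ≤ ((A ∩ Z).filter fun a => onZ Z ω ∈ openConn c a).card} with htS
  have hsq : τ₀ ^ 2 ≤ tS := by
    have h1 : τ₀ * τ₁ ≤ tS := real_blockTwo_ge_mul w A ha₀ ha₁ hne
    have h2 : τ₀ * τ₀ ≤ τ₀ * τ₁ := mul_le_mul_of_nonneg_left hle measureReal_nonneg
    nlinarith
  have hτ0 : 0 ≤ τ₀ := measureReal_nonneg
  have hτ1 : τ₀ ≤ 1 := measureReal_le_one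
  have hB1 : τ₀ ^ 2 * (1 - tS) ≤ 2 * tS * (1 - τ₀) := by
    -- `2 t_S (1−τ₀) − τ₀²(1−t_S) = (t_S − τ₀²)(1 + (1−τ₀)²) + τ₀²(1−τ₀)²`
    have e : 2 * tS * (1 - τ₀) - τ₀ ^ 2 * (1 - tS) = (tS - τ₀ ^ 2) * (1 + (1 - τ₀) ^ 2) + τ₀ ^ 2 * (1 - τ₀) ^ 2 := by ring
    have h1 : 0 ≤ (tS - τ₀ ^ 2) * (1 + (1 - τ₀) ^ 2) := mul_nonneg (by linarith) (by positivity)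
    have h2 : 0 ≤ τ₀ ^ 2 * (1 - τ₀) ^ 2 := by positivity
    linarith
  exact real_card_le_one_le_intrinsic w ho hc hw A t ha₀ hcut hEN hM hB1 hB2

/-! ## The mixed criterion: a comparison block plus the intrinsic argument for the virtual block -/

/-- **MIXED INTRINSIC CRITERION.**  `w'` agrees with `w` off the block `Z`, both hang a block on `Z` at `c`, and `P_{w'}(N ≤ 1) ≤ t` (e.g. `w'` =
independent stems and FAR(1) known there); `(h', t')` = the block numbers of `w'`, `λ ∈ [0,1)`.  If the VIRTUAL numbers
`h̃ = (h_S − λh')/(1−λ)`, `d̃ = (t_S − λt')/(1−λ)` satisfy `0 ≤ d̃ ≤ h̃`, `d̃ ≤ 1`, (B1) and (B2) — written division-free below — then `P_w(N ≤ 1) ≤ t`.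
PROOF: `P_w(N ≥ 2) = A₀ + B h_S + C t_S = (1−λ)(A₀ + B h̃ + C d̃) + λ(A₀ + B h' + C t') ≥ (1−λ)(1−t) + λ(1−t)`.  `λ = 0` is the intrinsic criterion;
`Block.real_card_le_one_le_of_dominates` is the boundary case in which the virtual block exits (`d̃ ≥ q`). [this work] -/
theorem real_card_le_one_le_of_mixIntrinsic (w w' : Sym2 (Fin n) → unitInterval) (ho : o ∉ Z) (hc : c ∉ Z)
    (hw : ∀ x y : Fin n, x ≠ y → x ∈ Z → y ∉ Z → y ≠ c → (w s(x, y) : ℝ) = 0)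
    (hw' : ∀ x y : Fin n, x ≠ y → x ∈ Z → y ∉ Z → y ≠ c → (w' s(x, y) : ℝ) = 0)
    (hagree : ∀ e ∈ avoid Z, w e = w' e)
    (A : Finset (Fin n)) (t lam : ℝ) (hlam0 : 0 ≤ lam) (hlam1 : lam < 1) {a₀ : Fin n} (ha₀ : a₀ ∈ A ∩ Z)
    (hcut : ∀ a ∈ A, (prodBernoulli w).real (openConn o a)ᶜ ≤ t)
    (hEN : (2 : ℝ) < ∑ a ∈ A, (prodBernoulli w).real (openConn o a))
    (hM : ∑ a ∈ A ∩ Z, (prodBernoulli w).real {ω | onZ Z ω ∈ openConn c a} ≤ 2)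
    (hD0 : lam * (prodBernoulli w').real {ω | 2 ≤ ((A ∩ Z).filter fun a => onZ Z ω ∈ openConn c a).card} ≤
      (prodBernoulli w).real {ω | 2 ≤ ((A ∩ Z).filter fun a => onZ Z ω ∈ openConn c a).card})
    (hDH : (prodBernoulli w).real {ω | 2 ≤ ((A ∩ Z).filter fun a => onZ Z ω ∈ openConn c a).card} -
        lam * (prodBernoulli w').real {ω | 2 ≤ ((A ∩ Z).filter fun a => onZ Z ω ∈ openConn c a).card} ≤
      (prodBernoulli w).real {ω | 1 ≤ ((A ∩ Z).filter fun a => onZ Z ω ∈ openConn c a).card} -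
        lam * (prodBernoulli w').real {ω | 1 ≤ ((A ∩ Z).filter fun a => onZ Z ω ∈ openConn c a).card})
    (hD1 : (prodBernoulli w).real {ω | 2 ≤ ((A ∩ Z).filter fun a => onZ Z ω ∈ openConn c a).card} -
        lam * (prodBernoulli w').real {ω | 2 ≤ ((A ∩ Z).filter fun a => onZ Z ω ∈ openConn c a).card} ≤ 1 - lam)
    (hB1 : (prodBernoulli w).real {ω | onZ Z ω ∈ openConn c a₀} ^ 2 *
        ((1 - lam) - ((prodBernoulli w).real {ω | 2 ≤ ((A ∩ Z).filter fun a => onZ Z ω ∈ openConn c a).card} -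
          lam * (prodBernoulli w').real {ω | 2 ≤ ((A ∩ Z).filter fun a => onZ Z ω ∈ openConn c a).card})) ≤
      2 * ((prodBernoulli w).real {ω | 2 ≤ ((A ∩ Z).filter fun a => onZ Z ω ∈ openConn c a).card} -
          lam * (prodBernoulli w').real {ω | 2 ≤ ((A ∩ Z).filter fun a => onZ Z ω ∈ openConn c a).card}) *
        (1 - (prodBernoulli w).real {ω | onZ Z ω ∈ openConn c a₀}))
    (hB2 : (prodBernoulli w).real {ω | onZ Z ω ∈ openConn c a₀} *
        ((1 - lam) - ((prodBernoulli w).real {ω | 2 ≤ ((A ∩ Z).filter fun a => onZ Z ω ∈ openConn c a).card} -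
          lam * (prodBernoulli w').real {ω | 2 ≤ ((A ∩ Z).filter fun a => onZ Z ω ∈ openConn c a).card})) ≤
      ((prodBernoulli w).real {ω | 2 ≤ ((A ∩ Z).filter fun a => onZ Z ω ∈ openConn c a).card} -
          lam * (prodBernoulli w').real {ω | 2 ≤ ((A ∩ Z).filter fun a => onZ Z ω ∈ openConn c a).card}) *
          (1 - (prodBernoulli w).real {ω | onZ Z ω ∈ openConn c a₀}) +
        (((prodBernoulli w).real {ω | 1 ≤ ((A ∩ Z).filter fun a => onZ Z ω ∈ openConn c a).card} -
            lam * (prodBernoulli w').real {ω | 1 ≤ ((A ∩ Z).filter fun a => onZ Z ω ∈ openConn c a).card}) -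
          ((prodBernoulli w).real {ω | 2 ≤ ((A ∩ Z).filter fun a => onZ Z ω ∈ openConn c a).card} -
            lam * (prodBernoulli w').real {ω | 2 ≤ ((A ∩ Z).filter fun a => onZ Z ω ∈ openConn c a).card})) *
          (2 - ∑ a ∈ A ∩ Z, (prodBernoulli w).real {ω | onZ Z ω ∈ openConn c a}))
    (hfar' : (prodBernoulli w').real {ω : BondConfig (Fin n) | (A.filter fun a => ω ∈ openConn o a).card ≤ 1} ≤ t) :
    (prodBernoulli w).real {ω : BondConfig (Fin n) | (A.filter fun a => ω ∈ openConn o a).card ≤ 1} ≤ t := by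
  set μ := prodBernoulli w with hμ
  set μ' := prodBernoulli w' with hμ'
  set A0 := μ.real {ω | 2 ≤ ((A \ Z).filter fun a => offZ Z ω ∈ openConn o a).card} with hA0
  set B := μ.real {ω | ((A \ Z).filter fun a => offZ Z ω ∈ openConn o a).card = 1 ∧ offZ Z ω ∈ openConn o c} with hB
  set C := μ.real {ω | ((A \ Z).filter fun a => offZ Z ω ∈ openConn o a).card = 0 ∧ offZ Z ω ∈ openConn o c} with hC
  set hS := μ.real {ω | 1 ≤ ((A ∩ Z).filter fun a => onZ Z ω ∈ openConn c a).card} with hhS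
  set tS := μ.real {ω | 2 ≤ ((A ∩ Z).filter fun a => onZ Z ω ∈ openConn c a).card} with htS
  set hP := μ'.real {ω | 1 ≤ ((A ∩ Z).filter fun a => onZ Z ω ∈ openConn c a).card} with hhP
  set tP := μ'.real {ω | 2 ≤ ((A ∩ Z).filter fun a => onZ Z ω ∈ openConn c a).card} with htP
  set τ₀ := μ.real {ω | onZ Z ω ∈ openConn c a₀} with hτ₀
  set M := ∑ a ∈ A ∩ Z, μ.real {ω | onZ Z ω ∈ openConn c a} with hMdef
  set e := 1 - lam with he
  have hepos : 0 < e := by rw [he]; linarith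
  -- (D) for `w` and `w'`; the environment coefficients agree
  have hD : μ.real {ω : BondConfig (Fin n) | 2 ≤ (A.filter fun a => ω ∈ openConn o a).card} = A0 + B * hS + C * tS :=
    real_two_le_card_eq w ho hc hw A
  have hD' : μ'.real {ω : BondConfig (Fin n) | 2 ≤ (A.filter fun a => ω ∈ openConn o a).card} = A0 + B * hP + C * tP := by
    have h := real_two_le_card_eq w' ho hc hw' A
    have e1 := real_offZ_event_eq_of_agree w w' Z hagree (fun η => 2 ≤ ((A \ Z).filter fun a => η ∈ openConn o a).card)
    have e2 := real_offZ_event_eq_of_agree w w' Z hagree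
      (fun η => ((A \ Z).filter fun a => η ∈ openConn o a).card = 1 ∧ η ∈ openConn o c)
    have e3 := real_offZ_event_eq_of_agree w w' Z hagree
      (fun η => ((A \ Z).filter fun a => η ∈ openConn o a).card = 0 ∧ η ∈ openConn o c)
    rw [hA0, hB, hC, hhP, htP, e1, e2, e3]
    exact h
  have hfar2 : 1 - t ≤ A0 + B * hP + C * tP := by
    have := real_card_le_one_eq_one_sub μ' A o
    rw [hD'] at this; linarith [hfar']
  -- the virtual block
  set hv := (hS - lam * hP) / e with hhv
  set dv := (tS - lam * tP) / e with hdv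
  have hd0 : 0 ≤ dv := div_nonneg (by linarith) hepos.le
  have hdh : dv ≤ hv := div_le_div_of_nonneg_right hDH hepos.le
  have hd1 : dv ≤ 1 := (div_le_one hepos).2 hD1
  have hdv' : tS - lam * tP = e * dv := by rw [hdv]; field_simp
  have hhv' : hS - lam * hP = e * hv := by rw [hhv]; field_simp
  have hB1v : τ₀ ^ 2 * (1 - dv) ≤ 2 * dv * (1 - τ₀) := by
    have h1 : e * (τ₀ ^ 2 * (1 - dv)) ≤ e * (2 * dv * (1 - τ₀)) := by
      have : τ₀ ^ 2 * (e - e * dv) ≤ 2 * (e * dv) * (1 - τ₀) := by rw [← hdv']; exact hB1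
      nlinarith
    exact le_of_mul_le_mul_left h1 hepos
  have hB2v : τ₀ * (1 - dv) ≤ dv * (1 - τ₀) + (hv - dv) * (2 - M) := by
    have h1 : e * (τ₀ * (1 - dv)) ≤ e * (dv * (1 - τ₀) + (hv - dv) * (2 - M)) := by
      have : τ₀ * (e - e * dv) ≤ (e * dv) * (1 - τ₀) + (e * hv - e * dv) * (2 - M) := by rw [← hdv', ← hhv']; exact hB2
      nlinarith
    exact le_of_mul_le_mul_left h1 hepos
  have hkey : 1 - t ≤ A0 + B * hv + C * dv :=
    real_intrinsic_env w ho hc hw A t ha₀ hcut hEN hM hd0 hdh hd1 hB1v hB2v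
  -- mix
  have hmix : A0 + B * hS + C * tS = e * (A0 + B * hv + C * dv) + lam * (A0 + B * hP + C * tP) := by
    have e1 : B * hS = B * (e * hv) + lam * (B * hP) := by rw [← hhv']; ring
    have e2 : C * tS = C * (e * dv) + lam * (C * tP) := by rw [← hdv']; ring
    rw [e1, e2, he]; ring
  have h1 : e * (1 - t) ≤ e * (A0 + B * hv + C * dv) := mul_le_mul_of_nonneg_left hkey hepos.le
  have h2 : lam * (1 - t) ≤ lam * (A0 + B * hP + C * tP) := mul_le_mul_of_nonneg_left hfar2 hlam0
  rw [real_card_le_one_eq_one_sub, hD, hmix]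
  rw [he] at h1 ⊢; linarith

end Block

end Quant

end Summit.CriticalPhenomena.PercolationContinuityZ3.Theorems
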